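import Literature.MathematicalPhysics.QuantumManyBody.JelliumSliceAlgebra
import Literature.MathematicalPhysics.QuantumManyBody.PeriodicBoseGasPQ
import Literature.MathematicalPhysics.QuantumManyBody.NeumannSymmetrization
import HarnessLib

/-!
# Bridge: the condensate projections of the Neumann box are Fournais's `Pᵢ`, `Qᵢ` on `Λ(u₀)`

Topic `Literature/MathematicalPhysics/QuantumManyBody` (the charged Bose gas, `JelliumBoseGas.foldyLaw`).
The tree already contains a calculus of the projections `Pᵢ` (box average in the `i`-th
variable) and `Qᵢ = 1 - Pᵢ` on `n`-body functions, for the sliding boxes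
`Λ(u) = u + [-ℓ/2, ℓ/2]³` of [Fournais2020, §2] (`BoseGas.nbodyP`, `BoseGas.nbodyQ`,
`PeriodicBoseGasSectorOps.lean`, `PeriodicBoseGasPQ.lean`: commutation, `L²` bounds, Fubini on
fibres `integral_integral_update`, the potential-energy decomposition of [Fournais2020, Lemma 2.2],
which is the first-quantized form of the splitting of `ŵ_{pq,μν}` by zero indices in
[LiebSolovej2001, §5]). The box `Λ_ℓ` of the jellium files is `Λ(u₀)` for the centre
`u₀ = (ℓ/2, ℓ/2, ℓ/2)` up to a null set, and the projections agree:

* `slidingBox_center_eq` — `Λ(u₀) = [0,ℓ]³`; `cell_ae_eq_closedCube`, `slidingBox_center_ae_eq_cell`,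
  `cellN_ae_eq_boxConfig` — `[0,ℓ)³ = [0,ℓ]³` and `cellN = boxConfig n ℓ u₀` a.e.;
* `sliceMean_eq_nbodyP`, `sliceFluct_eq_nbodyQ` — `PⱼΨ = nbodyP ℓ u₀ j Ψ`, `QⱼΨ = nbodyQ ℓ u₀ j Ψ`
  (`ℓ > 0`), so that the `PQ` calculus applies verbatim to the one-box Hamiltonian of
  [LiebSolovej2001, (3.9)].

## References

* [LiebSolovej2001] E. H. Lieb, J. P. Solovej, Commun. Math. Phys. 217 (2001) 127–163, §5.
* [Fournais2020] S. Fournais, *Length scales for BEC in the dilute Bose gas*, EMS Ser. Congr. Rep.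
  18 (2021), (2.5), (2.15), Lemma 2.2.
-/

noncomputable section

open MeasureTheory Set Filter Real
open scoped ENNReal NNReal Topology

namespace Literature.MathematicalPhysics.QuantumManyBody.JelliumBoseGas

open BoseGas

variable {n : ℕ}

/-! ### The centred sliding box is the closed box -/

/-- `Λ(u₀) = [0,ℓ]³` for the centre `u₀ = (ℓ/2,ℓ/2,ℓ/2)`. [cite: Fournais2020, (3.4)] -/
theorem slidingBox_center_eq (ℓ : ℝ) :
    slidingBox ℓ (WithLp.toLp 2 fun _ : Fin 3 => ℓ / 2) = {x : Space | ∀ k, x k ∈ Set.Icc 0 ℓ} := by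
  ext x
  simp only [slidingBox, Set.mem_setOf_eq, Set.mem_Icc]
  refine forall_congr' fun k => ?_
  constructor
  · rintro ⟨h1, h2⟩; exact ⟨by linarith, by linarith⟩
  · rintro ⟨h1, h2⟩; exact ⟨by linarith, by linarith⟩

/-- `[0,ℓ)³ = [0,ℓ]³` up to a null set. [folklore] -/
theorem cell_ae_eq_closedCube (ℓ : ℝ) :
    cell ℓ =ᵐ[volume] {x : Space | ∀ k, x k ∈ Set.Icc 0 ℓ} := by
  have hsub : cell ℓ ⊆ {x : Space | ∀ k, x k ∈ Set.Icc 0 ℓ} := fun x hx k => Set.Ico_subset_Icc_self (hx k)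
  refine ae_eq_set.2 ⟨by rw [Set.sdiff_eq_empty.2 hsub, measure_empty], ?_⟩
  refine measure_mono_null (t := ⋃ k : Fin 3, {x : Space | x k = ℓ}) ?_ ?_
  · rintro x ⟨hxc, hxb⟩
    simp only [cell, Set.mem_setOf_eq, not_forall] at hxb
    obtain ⟨k, hk⟩ := hxb
    have hc := hxc k
    simp only [Set.mem_iUnion, Set.mem_setOf_eq]
    refine ⟨k, ?_⟩
    rcases hc.2.eq_or_lt with h | h
    · exact h
    · exact absurd ⟨hc.1, h⟩ hk
  · exact measure_iUnion_null_iff.2 fun k => NeumannBox.volume_coord_eq_zero k ℓ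

/-- `Λ(u₀) = [0,ℓ)³` up to a null set. [folklore] -/
theorem slidingBox_center_ae_eq_cell (ℓ : ℝ) :
    slidingBox ℓ (WithLp.toLp 2 fun _ : Fin 3 => ℓ / 2) =ᵐ[volume] cell ℓ := by
  rw [slidingBox_center_eq]
  exact (cell_ae_eq_closedCube ℓ).symm

/-- **`cellN n ℓ = boxConfig n ℓ u₀` up to a null set** (`Λ_ℓ^n` versus `Λ(u₀)ⁿ`). [folklore] -/
theorem cellN_ae_eq_boxConfig (n : ℕ) (ℓ : ℝ) :
    cellN n ℓ =ᵐ[volume] boxConfig n ℓ (WithLp.toLp 2 fun _ : Fin 3 => ℓ / 2) := by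
  have hbox : boxConfig n ℓ (WithLp.toLp 2 fun _ : Fin 3 => ℓ / 2) =
      {X : Config n | ∀ i k, X i k ∈ Set.Icc 0 ℓ} := by
    ext X
    simp only [boxConfig, slidingBox_center_eq, Set.mem_setOf_eq]
  rw [hbox]
  have hsub : cellN n ℓ ⊆ {X : Config n | ∀ i k, X i k ∈ Set.Icc 0 ℓ} := fun X hX i k =>
    Set.Ico_subset_Icc_self (hX i k)
  refine ae_eq_set.2 ⟨by rw [Set.sdiff_eq_empty.2 hsub, measure_empty], ?_⟩
  refine measure_mono_null (t := ⋃ i : Fin n, ⋃ k : Fin 3, {X : Config n | X i k = ℓ}) ?_ ?_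
  · rintro X ⟨hXc, hXb⟩
    simp only [cellN, Set.mem_setOf_eq, not_forall] at hXb
    obtain ⟨i, hi⟩ := hXb
    simp only [cell, Set.mem_setOf_eq, not_forall] at hi
    obtain ⟨k, hk⟩ := hi
    have hc := hXc i k
    simp only [Set.mem_iUnion, Set.mem_setOf_eq]
    refine ⟨i, k, ?_⟩
    rcases hc.2.eq_or_lt with h | h
    · exact h
    · exact absurd ⟨hc.1, h⟩ hk
  · exact measure_iUnion_null_iff.2 fun i => measure_iUnion_null_iff.2 fun k =>
      volume_setOf_apply_eq_const n i k ℓ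

/-! ### `Pⱼ = nbodyP`, `Qⱼ = nbodyQ` -/

/-- **`PⱼΨ = nbodyP ℓ u₀ j Ψ`** (`ℓ > 0`). [cite: Fournais2020, (2.5), (2.15)] -/
theorem sliceMean_eq_nbodyP {ℓ : ℝ} (hℓ : 0 < ℓ) (j : Fin n) (Ψ : Config n → ℂ) (X : Config n) :
    sliceMean ℓ j Ψ X = nbodyP ℓ (WithLp.toLp 2 fun _ : Fin 3 => ℓ / 2) j Ψ X := by
  rw [sliceMean, setAverage_eq, volume_real_cell hℓ.le, nbodyP,
    setIntegral_congr_set (slidingBox_center_ae_eq_cell ℓ)]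

/-- **`QⱼΨ = nbodyQ ℓ u₀ j Ψ`** (`ℓ > 0`). [cite: Fournais2020, (2.5), (2.15)] -/
theorem sliceFluct_eq_nbodyQ {ℓ : ℝ} (hℓ : 0 < ℓ) (j : Fin n) (Ψ : Config n → ℂ) (X : Config n) :
    sliceFluct ℓ j Ψ X = nbodyQ ℓ (WithLp.toLp 2 fun _ : Fin 3 => ℓ / 2) j Ψ X := by
  rw [sliceFluct, nbodyQ, sliceMean_eq_nbodyP hℓ]

/-- As functions: `sliceMean ℓ j = nbodyP ℓ u₀ j` (`ℓ > 0`). [folklore] -/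
theorem sliceMean_eq_nbodyP' {ℓ : ℝ} (hℓ : 0 < ℓ) (j : Fin n) :
    (sliceMean ℓ j : (Config n → ℂ) → Config n → ℂ) = nbodyP ℓ (WithLp.toLp 2 fun _ : Fin 3 => ℓ / 2) j := by
  funext Ψ X; exact sliceMean_eq_nbodyP hℓ j Ψ X

/-- As functions: `sliceFluct ℓ j = nbodyQ ℓ u₀ j` (`ℓ > 0`). [folklore] -/
theorem sliceFluct_eq_nbodyQ' {ℓ : ℝ} (hℓ : 0 < ℓ) (j : Fin n) :
    (sliceFluct ℓ j : (Config n → ℂ) → Config n → ℂ) = nbodyQ ℓ (WithLp.toLp 2 fun _ : Fin 3 => ℓ / 2) j := by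
  funext Ψ X; exact sliceFluct_eq_nbodyQ hℓ j Ψ X

end Literature.MathematicalPhysics.QuantumManyBody.JelliumBoseGas
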